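import Literature.Topology.FourManifolds.ThetaFourKervaireMilnorProofs
import Literature.Topology.FourManifolds.PontryaginThomCollapseHolds
import Literature.Topology.FourManifolds.PiStableFourHomotopyGroup
import HarnessLib

/-!
# Kervaire–Milnor's §4 at `n = 4`: the frontier is `Π₄ = 0` alone

Topic `Literature/Topology/FourManifolds`; pure-proof file (theorems only: no definition, no named
fact) attached to `ThetaFourKervaireMilnor.lean` / `PiStableFourCollapse.lean` /
`ThetaFourKervaireMilnorProofs.lean`.  The named fact
`Literature.Topology.FourManifolds.HomotopySphere.boundsParallelizable_of_isStablyParallelizable_four`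
(Kervaire–Milnor, *Groups of homotopy spheres I*, Ann. of Math. 77 (1963), §4 at `n = 4`: an
s-parallelizable homotopy `4`-sphere bounds a parallelizable manifold) is reduced in the tree to the
three leaves (a) normally framed embedding, (b) Lemma 4.2 `⇒`, and `Π₄ = 0`
(`HomotopySphere.boundsParallelizable_of_isStablyParallelizable_four_of`, `PiStableFourCollapse.lean`);
`ThetaFourKervaireMilnorProofs.lean` fed (a) by its discharge.  Since then (b) has been discharged as
well (`boundsParallelizable_of_collapseNullHomotopic_holds`, `PontryaginThomCollapseHolds.lean`: Thom
transversality, the regular value theorem, Lemmas 3.3–3.5), so the fact — and with it `Θ₄ = bP₅` —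
now rests on the SINGLE named fact `piStable_four_trivial` (`Π₄ = π₄₊ₖ(Sᵏ) = 0`, `k > 5`; equivalently
the Mathlib statement `∀ k > 5, ∀ x, Subsingleton (π_ (4 + k) Sᵏ x)`,
`piStable_four_trivial_iff_subsingleton_homotopyGroup`, `PiStableFourHomotopyGroup.lean`):

* `HomotopySphere.boundsParallelizable_of_isStablyParallelizable_four_of_piStable` —
  `piStable_four_trivial → boundsParallelizable_of_isStablyParallelizable_four`;
* `HomotopySphere.boundsParallelizable_four_of_piStable` — `Θ₄ = bP₅` (every homotopy `4`-sphere
  bounds a parallelizable manifold) from Thm. 3.1 (`isStablyParallelizable`) and `Π₄ = 0`;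
* `HomotopySphere.boundsParallelizable_of_isStablyParallelizable_four_of_subsingleton_homotopyGroup` —
  the fact from the stem computation stated for Mathlib's `HomotopyGroup`.

The discharge `boundsParallelizable_of_isStablyParallelizable_four_holds` is the first theorem applied
to `piStable_four_trivial_holds` once the stable `4`-stem is computed in the tree.

## References

* M. Kervaire, J. Milnor, *Groups of homotopy spheres I*, Ann. of Math. (2) 77 (1963), 504–537: §4,
  p. 510 (the embedding, `p(M, φ)`, Lemma 4.2), table p. 512 (`Π₄ = 0`), Thm. 3.1 (p. 508).
  [KervaireMilnorAnnals1963]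
* A. Hatcher, *Algebraic Topology*, CUP (2002), §4.1, p. 346. [HatcherAT2002]
-/

noncomputable section

namespace Literature.Topology.FourManifolds

namespace HomotopySphere

/-- **Kervaire–Milnor's §4 at `n = 4` from `Π₄ = 0` alone.** The named fact
`boundsParallelizable_of_isStablyParallelizable_four` (an s-parallelizable homotopy `4`-sphere bounds a
parallelizable manifold; p. 510 with Lemma 4.2 and the table p. 512) follows from the single
remaining leaf `piStable_four_trivial` (`Π₄ = π₄₊ₖ(Sᵏ) = 0`, `k > 5`), the normally framed embedding
(a) and Lemma 4.2 `⇒` (b) being the tree theorems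
`exists_isSmoothEmbedding_isNormalFraming_of_isStablyParallelizable_holds` and
`boundsParallelizable_of_collapseNullHomotopic_holds`.
[cite: KervaireMilnorAnnals1963, §4, p. 510 (Lemma 4.2) and table p. 512 (Π₄ = 0)] -/
theorem boundsParallelizable_of_isStablyParallelizable_four_of_piStable (hPi : piStable_four_trivial) :
    boundsParallelizable_of_isStablyParallelizable_four :=
  boundsParallelizable_of_isStablyParallelizable_four_of_frontier
    boundsParallelizable_of_collapseNullHomotopic_holds hPi

/-- **`Θ₄ = bP₅` from Thm. 3.1 and `Π₄ = 0`**: every homotopy `4`-sphere bounds a parallelizable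
(compact, smooth, `5`-dimensional) manifold, GIVEN Kervaire–Milnor's Thm. 3.1
(`isStablyParallelizable`: homotopy spheres are s-parallelizable) and `Π₄ = 0` (`piStable_four_trivial`).
[cite: KervaireMilnorAnnals1963, Thm. 3.1 (p. 508) and §4 (p. 510; table p. 512: Θ₄/bP₅ ↪ Π₄/p(S⁴) = 0)] -/
theorem boundsParallelizable_four_of_piStable (h31 : isStablyParallelizable)
    (hPi : piStable_four_trivial) : ∀ S : HomotopySphere 4, S.BoundsParallelizable :=
  boundsParallelizable_four_of h31 (boundsParallelizable_of_isStablyParallelizable_four_of_piStable hPi)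

/-- **Kervaire–Milnor's §4 at `n = 4` from the stable `4`-stem in Mathlib's vocabulary**: if
`π_ (4 + k) Sᵏ x` is trivial for every `k > 5` and every base point `x` of the Euclidean unit sphere
(Kervaire–Milnor's table p. 512, `Π₄ = 0`; Serre, Toda), then every s-parallelizable homotopy
`4`-sphere bounds a parallelizable manifold
(`piStable_four_trivial_of_subsingleton_homotopyGroup`, `PiStableFourHomotopyGroup.lean`).
[cite: KervaireMilnorAnnals1963, §4, p. 510 and table p. 512 (Π₄ = 0)] [cite: HatcherAT2002, §4.1 (p. 346)] -/
theorem boundsParallelizable_of_isStablyParallelizable_four_of_subsingleton_homotopyGroup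
    (h : ∀ k : ℕ, 5 < k → ∀ x : Metric.sphere (0 : EuclideanSpace ℝ (Fin (k + 1))) 1,
      Subsingleton
        (HomotopyGroup (Fin (4 + k)) (Metric.sphere (0 : EuclideanSpace ℝ (Fin (k + 1))) 1) x)) :
    boundsParallelizable_of_isStablyParallelizable_four :=
  boundsParallelizable_of_isStablyParallelizable_four_of_piStable
    (piStable_four_trivial_of_subsingleton_homotopyGroup h)

end HomotopySphere

end Literature.Topology.FourManifolds

end
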